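import Summits.QuantumFields.YangMills.Theorems.BalabanUVNodesN06SectBStepUParKnitRecordNB
import Literature.MathematicalPhysics.QuantumFieldTheory.Balaban1983to89.B9Thm311KnitRow17ThresholdsY

/-!
# Balaban UV-stability nodes, N06 [B9] Sect. B — «K2-G-REC-T»: THE KNIT SECT.-B `hBK` SUPPLIER WITH ROW 17 DISCHARGED AT dag-n06-j's NAMED THRESHOLD —
# `N06SectBStepUParKnitRecordNB.sectBStepUPar_knitRecordKCNBΔ` WITHOUT ITS `∃ aΔ`: the smallness of Theorem 3.11 is ONE displayed x-free numeric `aInv ≤ knitRow17a₁ N θ M⋆`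

[B9] = T. Bałaban, *Propagators for lattice gauge theories in a background field*, Commun. Math. Phys. **99** (1985) 389–434 [`Balaban1985BackgroundPropagators`];
[4] = T. Bałaban, *Propagators and renormalization transformations for lattice gauge theories. II*, Commun. Math. Phys. **96** (1984) 223–250 [`Balaban1984PropagatorsII`];
[5] = T. Bałaban, *Averaging operations for lattice gauge theories*, Commun. Math. Phys. **98** (1985) 17–51 [`Balaban1985Averaging`].

statement-level skeleton of published theorems with citation tags; proofs where landed; nothing here is a claim about the Yang–Mills mass gap

THE PRINT.  Thm 3.4 p. 400 and Sect. B pp. 400–407 (the analytic extension in the background, read on functions with values in the `N × N` hermitian matrices through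
real coordinates, pp. 391–392); Thm 3.11 p. 416 («the operators Δ′_a, G′, (Q′G′²Q′\*)⁻¹, Δ_a, G are positive definite … for M sufficiently large and α₀ sufficiently small»);
(3.35) p. 396 (the cube class); (3.19) p. 393 (the knit transporters); [4] Lemma 2.1 (2.59)–(2.61) pp. 233–234; [5] Prop. 2 p. 26.

WHY (seat `pub-ymgap-dag-n06-c` gen 29; cell `pub-ymgap`, HUMAN RULING D-0062, Track A node N06; CASCADE-K, K2-G lane).  The knit certificate head («KE₅X», dag-n06-d) folds
its coded Sect.-B step `hBK` with `N06SectBStepUParKnitRecordNB.sectBStepUPar_knitRecordKCNB` (✓, gen 28) and so still displays the row-17 LAW `hΔAK` (Thm 3.11 for `Δ_a^𝔮`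
over ALL members, on a regime family `R₁` bridged to (3.35) by `hP1`).  Gen 28's edition 2 discharged that law inside the supplier (`…KCNBΔ`: every member of the sub-family
carries a section, dag-n06-j's law-free `B9Thm311PosDefQknitAtKnitLetterLawFreeY.symm_posDefTr_deltaAQY_knitRecord_at_scMember` applies) at the price of an OPAQUE
`∃ aΔ > 0, ∀ aInv ≤ aΔ, …` around the whole statement — a shape a certificate that displays its class constant `aInv` cannot fold.  dag-n06-j's ✓
`B9Thm311KnitRow17ThresholdsY` (2026-08-31, on this seat's offer) NAMES the two existential constants as closed terms `knitRow17M₁ N θ M⋆`, `knitRow17a₁ N θ M⋆` and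
supplies the guarded unit along sections `hunitAQ_knitRecord_of_sections_at (hMInv : knitRow17M₁ ≤ MInv) (haInv : aInv ≤ knitRow17a₁)`.  THIS FILE removes the `∃`:
★★★ `sectBStepUPar_knitRecordKCNBT` keeps the certificate's own `aInv` and displays the smallness as ONE x-free numeric `haIT : aInv ≤ knitRow17a₁ N θ M⋆`; the member
threshold is absorbed by the Sect.-B step's own `∃ M₀` at `MInv := knitRow17M₁ N θ M⋆ + |r_LB| + 2(d+1) + 2` (exactly as in `…KCNBΔ`).  (A separate module because
`…KnitRecordNB` is at the 400-line cap for Theorems files with proofs.)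

WHAT IS PROVED (sorry-free; 0 `def`).  ★★★ `sectBStepUPar_knitRecordKCNBT` — binders = `…KCNB`'s IN ITS ORDER with the regime ∕ row-17 group `c hP1 MR aR hΔAK haIR` (and the
implicit `R₁ R₂`) REPLACED by `haIT`: `hι hCqK haInv haIT hαK hαQ hα8 hα4N hαπN hKplK haIK hϱ′ hϱ hsmall′ hc₃′ hϱ′1 hE hdX hsmall hc₃ hM₀K h32 h33`; conclusion = `…KCNB`'s
`SectBStepUPar extraYPb f (d+1) c35Y SU(N) b parKnitY parSymY GAQY(knit pair) parBY (C37KY … (cqY d₆) CqK MK aInv (ϱ′L³∕3)) C38 CinvY` VERBATIM.  Proof = `…KCNBΔ`'s with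
`hunitA := hunitAQ_knitRecord_of_sections_at … haIT f ιB hι` and `knitRow17M₁_pos` for `0 < MInv`.

CONSUMER RECIPE (a certificate that no longer reads `hΔAK` over all members — dag-n06-d's J-indexed KA ed.2 ∕ a later KE; until then KE₅X∕KE₆X keep `…KCNB`, since
KCX‴'s `t311` and KD‴ read `hΔAK` over all members).  `hBK := fun h32 h33 => …N06SectBStepUParKnitRecordNBT.sectBStepUPar_knitRecordKCNBT (instNE := fun x =>
B9Thm39ReadingCoords.bondIdx_nonempty _) θ.toStage3Params Mstar f bR ιB C38 CqK MK aInv hι hCqK haInv haIT hαK hαQK hα8 hα4N hαπN hKplK haIK hϱ' hϱ hsmall' hc₃' hϱ'1 hEc hdX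
hsmall hc₃ hM₀K h32 h33` with the new head display `(haIT : aInv ≤ knitRow17a₁ N θ.toStage3Params Mstar)` — INHABITED (`knitRow17a₁_pos`: every `aInv ∈ (0, knitRow17a₁]`);
`hι` INHABITED exactly at section-carrying members (`B9SectionCarryingMembersV1.ιBsc ∕ hιsc`; LOCATED-19: not at every member).

HONEST SCOPE.  Instantiation ∕ bookkeeping of landed theorems (three `linarith` threshold checks); conditional on dag-n06-j's law-free Theorem 3.11 at section-carrying members
(a THEOREM in tree), on `h32`, `h33` and the window numerics exactly as `…KCNB`; a HELPER by key 27239 (KEY MAP v3) — NOT the discharge of any N06 obligation; count-neutral;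
nothing continuum ∕ OS ∕ mass gap ∕ Clay — the Yang–Mills mass gap is NOT proved here.  RELATED, NOT DUPLICATED (2026-08-31: `rg -l -w "N06SectBStepUParKnitRecordNBT|
sectBStepUPar_knitRecordKCNBT"` over `lean/{Summits,Literature,HarnessLib}` = ∅): `…KnitRecordNB` §2–§4 (USED: its §1 basis lemmas; `…KCNBΔ` is the `∃` form of this theorem),
`…KnitRecordN.sectBStepUPar_knitRecordN` (the engine, USED), dag-n06-j `B9Thm311KnitRow17ThresholdsY` (USED).  2026-08-31.
-/

noncomputable section

namespace Summit.QuantumFields.YangMills.BalabanUVNodes.N06SectBStepUParKnitRecordNBT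

open scoped Matrix Matrix.Norms.L2Operator
open Literature.MathematicalPhysics.QuantumFieldTheory.Balaban1983to89
open Literature.MathematicalPhysics.QuantumFieldTheory.Balaban1983to89.Node00 (BlkY IBondY CfgY GAQY GpY deltaAQY parSymY parBY kernelFamilyS kernelFamilyB
  Stage3Params cqY)
open Literature.MathematicalPhysics.QuantumFieldTheory.Balaban1983to89.Node00.OpsYQLetter (qKnitOfRecord qsKnitOfRecord)
open Literature.MathematicalPhysics.QuantumFieldTheory.Balaban1983to89.B6Ineq2142KLevelV1 (β)
open Literature.MathematicalPhysics.QuantumFieldTheory.Balaban1983to89.B6KLevelCensusIndexV1 (KIdx kGeo)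
open Literature.MathematicalPhysics.QuantumFieldTheory.Balaban1983to89.B9PinMembersKLevelV1 (MemberY geo9Y)
open Literature.MathematicalPhysics.QuantumFieldTheory.Balaban1983to89.B9PinGeometryKLevelV1 (c35Y)
open Literature.MathematicalPhysics.QuantumFieldTheory.Balaban1983to89.B9SectBCodedClassR (bg9YC extraYPb)
open Literature.MathematicalPhysics.QuantumFieldTheory.Balaban1983to89.B9Eq360DeltaPrimeAY (AfldY)
open Literature.MathematicalPhysics.QuantumFieldTheory.Balaban1983to89.B9SectBCodedReadingsUParH (SectBStepUPar)
open Literature.MathematicalPhysics.QuantumFieldTheory.Balaban1983to89.B9SectBKerFrameCodedYR (CinvY)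
open Literature.MathematicalPhysics.QuantumFieldTheory.Balaban1983to89.B9Eq340TaxiContourLocalityY (rLB)
open Literature.MathematicalPhysics.QuantumFieldTheory.Balaban1983to89.B9SectBCodedClassKnitY (C37KY)
open Literature.MathematicalPhysics.QuantumFieldTheory.Balaban1983to89.B7Prop2Explicit (c2')
open Literature.MathematicalPhysics.QuantumFieldTheory.Balaban1983to89.B7Prop2SpecialUnitary (specialUnitaryUnits)
open Literature.MathematicalPhysics.QuantumFieldTheory.Balaban1983to89.B7Prop3Flat (c3)
open Literature.MathematicalPhysics.QuantumFieldTheory.Balaban1983to89.B7Prop5CplxLevels (epsCplx tauCplx)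
open Literature.MathematicalPhysics.QuantumFieldTheory.Balaban1983to89.B9Eq316AveragingTransposeZd (alphaQ)
open Literature.MathematicalPhysics.QuantumFieldTheory.Balaban1983to89.B9C2FormBoxRegimeY (Kpl)
open Literature.MathematicalPhysics.QuantumFieldTheory.Balaban1983to89.B9B8AveragingJunction (parKnitY)
open Literature.MathematicalPhysics.QuantumFieldTheory.Balaban1983to89.B9Thm39ReadingCoords (coordBound39 abs_repr_le)
open Literature.MathematicalPhysics.QuantumFieldTheory.Balaban1983to89.B9GeoNbrCountKLevelV1 (nbrM₀Y nbrCountY hnbr_of_le)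
open Literature.MathematicalPhysics.QuantumFieldTheory.Balaban1983to89.B9Thm311KnitRow17ThresholdsY (knitRow17M₁ knitRow17a₁ knitRow17M₁_pos
  hunitAQ_knitRecord_of_sections_at)
open Summit.QuantumFields.YangMills.BalabanUVNodes.N06SectBStepUParKnitRecordN (sectBStepUPar_knitRecordN)
open Summit.QuantumFields.YangMills.BalabanUVNodes.N06SectBStepUParKnitRecordNB (coordBound39_pos coordBound39_mul_sum_norm_pos
  sqrt_card_mul_coordBound39_mul_sum_norm_pos)

/-! ## §1 The knit Sect.-B `hBK` supplier with row 17 discharged at the named threshold: one displayed numeric -/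

section Record

variable {N : ℕ} [Nonempty (Fin N)] (θ : Stage3Params) (Mstar : ℕ)
variable {ι : Type} [Fintype ι] [DecidableEq ι]
variable {J : Type} (f : J → MemberY θ.d₆ θ.ℓ₆ θ.hd' θ.hL' θ.b₀ θ.b₁ Mstar)
  [∀ x : MemberY θ.d₆ θ.ℓ₆ θ.hd' θ.hL' θ.b₀ θ.b₁ Mstar, Fintype (geo9Y x).Site]
  [instDS : ∀ x : MemberY θ.d₆ θ.ℓ₆ θ.hd' θ.hL' θ.b₀ θ.b₁ Mstar, DecidableEq (geo9Y x).Site]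
  [instNE : ∀ x : MemberY θ.d₆ θ.ℓ₆ θ.hd' θ.hL' θ.b₀ θ.b₁ Mstar, Nonempty (geo9Y x).Site]
  (b : Module.Basis ι ℝ (Matrix (Fin N) (Fin N) ℂ)) (ιB : ∀ j : J, BlkY (f j).toKIdx → IBondY (f j).toKIdx)
  (C38 : ∀ j : J, ℝ → CfgY (Matrix (Fin N) (Fin N) ℂ) (f j).toKIdx → AfldY (Matrix (Fin N) (Fin N) ℂ) (f j).toKIdx → Prop)
  (CqK MK aInv : ℝ)


/-- ★★★ **THE KNIT SECT.-B `hBK` SUPPLIER WITH ROW 17 DISCHARGED AT THE NAMED THRESHOLD** (law-free, bridge-free, `∃`-free): `…NB.sectBStepUPar_knitRecordKCNBΔ`'s statement with the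
opaque `∃ aΔ` replaced by the ONE displayed x-free numeric `haIT : aInv ≤ knitRow17a₁ N θ M⋆` — dag-n06-j's name (`B9Thm311KnitRow17ThresholdsY`) for print's «α₀
sufficiently small» of Theorem 3.11 at the knit pair of record on the class (3.35); every member `f j` carries the section `ιB j` (`hι`), so
`hunitAQ_knitRecord_of_sections_at` gives the guarded knit Thm 3.11 unit («symmetric, positive — hence invertible») at the family's members above the member threshold
`MInv := knitRow17M₁ N θ M⋆ + |r_LB| + 2(d+1) + 2`, which the Sect.-B step's own `∃ M₀` absorbs (as in `…KCNBΔ`).  Binders = `…KCNB`'s in its order with `c hP1 MR aR hΔAK haIR` ↦ `haIT`;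
conclusion = `…KCNB`'s verbatim. [cite: Balaban1985BackgroundPropagators, Thm 3.4 p.400, Sect. B pp.400–407, Thm 3.11 p.416 («for M sufficiently large and α₀ sufficiently small»), (3.19) p.393, (3.35)–(3.37) p.396, Thms 3.2–3.3 pp.398–399; Balaban1984PropagatorsII, Lemma 2.1 (2.59)–(2.61) pp.233–234, (2.3) p.224; Balaban1985Averaging, Prop. 2 p.26, Prop. 7 p.43] -/
theorem sectBStepUPar_knitRecordKCNBT [NormOneClass (Matrix (Fin N) (Fin N) ℂ)] [FiniteDimensional ℝ (Matrix (Fin N) (Fin N) ℂ)]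
    (hι : ∀ (j : J) (s : BlkY (f j).toKIdx), β (f j).toKIdx.hN (f j).toKIdx.D (f j).toKIdx.hk (ιB j s) = s)
    (hCqK : 0 ≤ CqK) (haInv : 0 < aInv) (haIT : aInv ≤ knitRow17a₁ N θ Mstar)
    {α₀K aK : ℝ} (hαK : 0 < α₀K) (hαQ : α₀K ≤ alphaQ (θ.d₆ + 1) (θ.ℓ₆ + 1)) (hα8 : 8 * α₀K ≤ c2' (θ.d₆ + 1) (θ.ℓ₆ + 1))
    (hα4N : 32 * (((θ.d₆ + 1 : ℕ) : ℝ) + 1) * ((θ.d₆ + 1 : ℕ) + 4) * (((θ.ℓ₆ + 1 : ℕ) : ℝ)) ^ 2 * α₀K ≤ 1 / 4) (hαπN : (N : ℝ) * (32 * (((θ.d₆ + 1 : ℕ) : ℝ) + 1) * ((θ.d₆ + 1 : ℕ) + 4) * (((θ.ℓ₆ + 1 : ℕ) : ℝ)) ^ 2 * α₀K) < Real.pi)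
    (hKplK : ∀ (i : KIdx θ.d₆ θ.ℓ₆ θ.hd' θ.hL' θ.b₀ θ.b₁) (a : ℝ), 0 ≤ a → a ≤ aK → Kpl i a * (kGeo i).L ^ 4 < α₀K) (haIK : aInv ≤ aK)
    {ϱ' ϱ : ℝ} (hϱ' : 0 < ϱ') (hϱ : 0 < ϱ)
    (hsmall' : Real.exp (4 * (800 * (((θ.d₆ + 1 : ℕ) : ℝ) + 1) ^ 2 * (((θ.d₆ + 1 : ℕ) : ℝ) + 4)) * α₀K)
      * (1 + 8 * (131072 * (((θ.d₆ + 1 : ℕ) : ℝ) + 1) ^ 2) * ϱ') ≤ 2)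
    (hc₃' : 2 * ϱ' ≤ c3 (θ.d₆ + 1) (θ.ℓ₆ + 1)) (hϱ'1 : 409600 * (((θ.d₆ + 1 : ℕ) : ℝ) + 1) ^ 2 * ϱ' ≤ 1)
    (hE : epsCplx (θ.d₆ + 1) (θ.ℓ₆ + 1) ϱ' 0 ≤ 1 / 16)
    (hdX : ((θ.d₆ + 1 : ℕ) : ℝ) * (epsCplx (θ.d₆ + 1) (θ.ℓ₆ + 1) ϱ' 0 + tauCplx (θ.d₆ + 1) (θ.ℓ₆ + 1) α₀K 0 ϱ' 0) ≤ 1 / 16)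
    (hsmall : Real.exp (4480 * (((θ.d₆ + 1 : ℕ) : ℝ) + 1) ^ 2 * (((θ.d₆ + 1 : ℕ) : ℝ) + 4) * α₀K + 240000 * (((θ.d₆ + 1 : ℕ) : ℝ) + 1) ^ 3 * ϱ')
      * (1 + 8 * (2097152 * (((θ.d₆ + 1 : ℕ) : ℝ) + 1) ^ 2) * ϱ) ≤ 2)
    (hc₃ : 2 * ϱ ≤ c3 (θ.d₆ + 1) (θ.ℓ₆ + 1) / 4)
    (hM₀K : nbrM₀Y θ.d₆ θ.ℓ₆ θ.hd' θ.hL' θ.b₀ θ.b₁ (2 * ((θ.d₆ : ℝ) + 1)) ≤ Mstar)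
    (h32 : B9.Thm32Printed (θ.d₆ + 1) c35Y (fun j => geo9Y (f j))
      (fun j => bg9YC (Matrix (Fin N) (Fin N) ℂ) (specialUnitaryUnits (Fin N)) (extraYPb (Matrix (Fin N) (Fin N) ℂ) (specialUnitaryUnits (Fin N))) (f j))
      (CinvY (extraYPb (Matrix (Fin N) (Fin N) ℂ) (specialUnitaryUnits (Fin N))) f (specialUnitaryUnits (Fin N)) (fun j => parKnitY (f j).toKIdx)))
    (h33 : B9.Thm33Printed c35Y (fun j => geo9Y (f j))
      (fun j => bg9YC (Matrix (Fin N) (Fin N) ℂ) (specialUnitaryUnits (Fin N)) (extraYPb (Matrix (Fin N) (Fin N) ℂ) (specialUnitaryUnits (Fin N))) (f j))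
      (fun j => kernelFamilyS (f j).toKIdx
        (bg9YC (Matrix (Fin N) (Fin N) ℂ) (specialUnitaryUnits (Fin N)) (extraYPb (Matrix (Fin N) (Fin N) ℂ) (specialUnitaryUnits (Fin N))) (f j)) (fun U => U)
        (GpY (f j).toKIdx (parKnitY (f j).toKIdx)) (parSymY (f j).toKIdx))
      (fun j => kernelFamilyB (f j).toKIdx
        (bg9YC (Matrix (Fin N) (Fin N) ℂ) (specialUnitaryUnits (Fin N)) (extraYPb (Matrix (Fin N) (Fin N) ℂ) (specialUnitaryUnits (Fin N))) (f j)) (fun U => U)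
        (GAQY (f j).toKIdx (qKnitOfRecord N θ (f j).toKIdx) (qsKnitOfRecord N θ (f j).toKIdx) (parKnitY (f j).toKIdx) (GpY (f j).toKIdx (parKnitY (f j).toKIdx)))
        (parBY (f j).toKIdx))) :
    SectBStepUPar (extraYPb (Matrix (Fin N) (Fin N) ℂ) (specialUnitaryUnits (Fin N))) f (θ.d₆ + 1) c35Y (specialUnitaryUnits (Fin N)) b
      (fun j => parKnitY (f j).toKIdx) (fun j => parSymY (f j).toKIdx)
      (fun j => GAQY (f j).toKIdx (qKnitOfRecord N θ (f j).toKIdx) (qsKnitOfRecord N θ (f j).toKIdx) (parKnitY (f j).toKIdx) (GpY (f j).toKIdx (parKnitY (f j).toKIdx)))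
      (fun j => parBY (f j).toKIdx)
      (fun j => C37KY (specialUnitaryUnits (Fin N)) (f j) (ιB j)
        (fun α₀ U => (bg9YC (Matrix (Fin N) (Fin N) ℂ) (specialUnitaryUnits (Fin N)) (extraYPb (Matrix (Fin N) (Fin N) ℂ) (specialUnitaryUnits (Fin N))) (f j)).Reg335 c35Y α₀ U)
        (cqY θ.d₆) CqK MK aInv (ϱ' * (((θ.ℓ₆ + 1 : ℕ) : ℝ)) ^ 3 / 3))
      C38 (CinvY (extraYPb (Matrix (Fin N) (Fin N) ℂ) (specialUnitaryUnits (Fin N))) f (specialUnitaryUnits (Fin N)) (fun j => parKnitY (f j).toKIdx)) := by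
  have hM₁ : 0 < knitRow17M₁ N θ Mstar := knitRow17M₁_pos N θ Mstar
  have habs : rLB θ.d₆ θ.ℓ₆ ≤ |rLB θ.d₆ θ.ℓ₆| := le_abs_self _
  have habs0 : 0 ≤ |rLB θ.d₆ θ.ℓ₆| := abs_nonneg _
  have hd0 : (0 : ℝ) ≤ 2 * ((θ.d₆ : ℝ) + 1) := by positivity
  -- the guarded knit Thm 3.11 unit at the family's (section-carrying) members, at the NAMED thresholds of row 17 (dag-n06-j)
  have hunitA : ∀ j (α₀ : ℝ) (U : CfgY (Matrix (Fin N) (Fin N) ℂ) (f j).toKIdx), knitRow17M₁ N θ Mstar + |rLB θ.d₆ θ.ℓ₆| + 2 * ((θ.d₆ : ℝ) + 1) + 2 ≤ (geo9Y (f j)).M →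
      0 < α₀ → (geo9Y (f j)).M * α₀ ≤ aInv →
      (bg9YC (Matrix (Fin N) (Fin N) ℂ) (specialUnitaryUnits (Fin N)) (extraYPb (Matrix (Fin N) (Fin N) ℂ) (specialUnitaryUnits (Fin N))) (f j)).Reg335 c35Y α₀ U →
      IsUnit (deltaAQY (f j).toKIdx (qKnitOfRecord N θ (f j).toKIdx) (qsKnitOfRecord N θ (f j).toKIdx) (parKnitY (f j).toKIdx)
        (GpY (f j).toKIdx (parKnitY (f j).toKIdx)) U) :=
    fun j α₀ U hM hα ha hU => hunitAQ_knitRecord_of_sections_at N θ Mstar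
      (MInv := knitRow17M₁ N θ Mstar + |rLB θ.d₆ θ.ℓ₆| + 2 * ((θ.d₆ : ℝ) + 1) + 2) (by linarith) haIT f ιB hι j α₀ U hM hα ha hU
  exact sectBStepUPar_knitRecordN θ Mstar f b ιB C38 CqK MK aInv hι (coordBound39 b) (coordBound39_pos b).le (abs_repr_le b)
    (coordBound39_mul_sum_norm_pos b) (sqrt_card_mul_coordBound39_mul_sum_norm_pos b) hCqK
    (knitRow17M₁ N θ Mstar + |rLB θ.d₆ θ.ℓ₆| + 2 * ((θ.d₆ : ℝ) + 1) + 2) 1 (by linarith) haInv one_pos hαK hαQ hα8 hα4N hαπN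
    (fun j a h0 ha => hKplK (f j).toKIdx a h0 (ha.trans haIK)) hϱ' hϱ hsmall' hc₃' hϱ'1 hE hdX hsmall hc₃ hunitA (by linarith)
    (nbrCountY θ.d₆ θ.ℓ₆ θ.hd' θ.hL' θ.b₀ θ.b₁ (2 * ((θ.d₆ : ℝ) + 1))) (fun j y' => hnbr_of_le hM₀K (f j) y') (by linarith) h32 h33

end Record

end Summit.QuantumFields.YangMills.BalabanUVNodes.N06SectBStepUParKnitRecordNBT

end
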